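import Literature.Analysis.FluidPDE.PassiveVectorEnergyEquality
import HarnessLib

/-!
# Registered stub `stub_lowerEnergy` (V2) of support item `CascadeBookkeeping`
(route `AnomalousDissipation/SolenoidalFractalHomogenisation`, item stmt-AnomalousDissipation-19074, skeleton
`energy-road` registered 2026-08-27 by seat ad-solenoidal-cb-p1; cell ad-ideate)

**The lower energy inequality for A0 weak solutions** — for `ν > 0`, a (jointly continuous) carrier `b` with
bounded space–time lift on `(0,1) × T³` (weakly divergence free at every time) and an `H¹ ∩ L²` mean-zero weakly
divergence-free datum `w₀`, every weak solution `Torus.IsWeakPassiveVectorOn 0 1 ν b w₀ w` satisfies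
`‖w₀‖² ≤ ‖w(t)‖² + 2ν∫₀ᵗ‖∇w‖²` for a.e. `t ∈ (0,1)` (in `[0,∞]`). This is the special case `T = 1`, `d = 3` of
the Literature energy EQUALITY `IsWeakPassiveVectorOn.ae_energy_eq` (`PassiveVectorEnergyEquality`: Galerkin
form of the Lions–Shinbrot argument on the weak solution, with the `L²_t H¹_x` regularity of
`PassiveVectorDissipationBound`); only boundedness of the carrier and `w₀ ∈ L²` weakly divergence free are used.
With the landed composition `cascadeBookkeeping_of_exists_of_lowerEnergy`
(`Theorems/SolenoidalFractalHomogenisationCascadeBookkeepingComposition`, p528227) the item `CascadeBookkeeping` is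
thereby closed modulo the existence stub `stub_existence` (V1) alone. (Route-independent file: no Theses import.)
-/

set_option linter.dupNamespace false

noncomputable section

namespace Summit.AnomalousDissipation.AnomalousDissipation.Theorems.SolenoidalFractalHomogenisation.CascadeBookkeeping

open Set MeasureTheory Function
open scoped ENNReal
open Literature.Analysis.FunctionSpaces Literature.Analysis.FunctionSpaces.Torus Literature.Analysis.FluidPDE.Torus

/-- **Registered stub `stub_lowerEnergy` (V2) of `CascadeBookkeeping`**: the lower energy inequality
`‖w₀‖² ≤ ‖w(t)‖² + 2ν∫₀ᵗ‖∇w‖²` (a.e. `t ∈ (0,1)`, in `[0,∞]`) for every A0 weak solution with bounded carrier and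
`L²` weakly divergence-free datum — by the energy equality `IsWeakPassiveVectorOn.ae_energy_eq`.
[cite: Temam1984, Ch. III §1 Lemma 1.2] -/
theorem stub_lowerEnergy : ∀ ν : ℝ, 0 < ν → ∀ b : ℝ → UnitAddTorus (Fin 3) → EuclideanSpace ℝ (Fin 3),
    Continuous (uncurry b) →
    MemLp (stLift b) ∞ (volume.restrict (Ioo 0 1 ×ˢ (univ : Set (EuclideanSpace ℝ (Fin 3))))) →
    (∀ t, IsWeaklyDivFree (b t)) →
    ∀ w₀ : UnitAddTorus (Fin 3) → EuclideanSpace ℝ (Fin 3),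
    MemSobolev 1 (EuclideanSpace.complexify ∘ w₀) → MemLp w₀ 2 volume → HasZeroMean w₀ →
    IsWeaklyDivFree w₀ →
    ∀ w, IsWeakPassiveVectorOn 0 1 ν b w₀ w →
      ∀ᵐ t ∂(volume.restrict (Ioo 0 1)),
        ENNReal.ofReal (vectorL2Sq w₀) ≤ ENNReal.ofReal (vectorL2Sq (w t)) + 2 * eVectorDissipation ν w 0 t := by
  intro ν hν b _ hb _ w₀ _ hw₀ _ hdiv w hw
  exact hw.ae_lower_energy_ineq hν hw₀ hdiv hb

end Summit.AnomalousDissipation.AnomalousDissipation.Theorems.SolenoidalFractalHomogenisation.CascadeBookkeeping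

end
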